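import Summits.CriticalPhenomena.PercolationContinuityZ3.Theorems.PercNearOneGluingNoHeavyLowerTailKnQuestion8CoefficientwiseZStar
import HarnessLib

/-!
# The BOX reduction of the coefficientwise point row: wall at `z` ⟸ (wall ⊔ no-core) boxes on `G − z` (prim-lf-2 gen 46)

Support file (`--supports stmt-CriticalPhenomena-4575`, closed), prover `prim-lf-2` (gen 46).  No definitions, no named facts, no sorries; standard axioms.
Memo `prim-lf-2/CW-BOX-gen46.md` (§0(ii), §2(a)); the resolution of the wall vertex's star is gen 33's `Coefficientwise.wall_sum_zStar_prod`.

Setting.  Finite edge set `E` on `V` (`ends : ι → Sym2 V`), root `x`, wall vertex `z ≠ x`; `E₀` = the edges avoiding `z`, `Ez` = the edges at `z`; a colouring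
`s₀ ⊆ E₀` has red cluster `K = C_x(s₀)` and blue cluster `K̄ = C_x(E₀ ∖ s₀)`; for a `z`-edge `i` write `A_i(s₀)` = 'no end `v ≠ z` of `i` lies in `K`' and `B_i(s₀)` =
'no end `v ≠ z` of `i` lies in `K̄`'.  In the reach-count language of the memo (`t_v = [v ∈ K] + [v ∈ K̄]`): `A_i ∧ B_i` = WALL at the far end (`t_v = 0`) and
`A_i ∨ B_i` = NO-CORE at the far end (`t_v ≤ 1`, the far end is not doubly reached).  By (P4) the wall sum over `E` is the sum over `G − z` weighted by
`∏_{i ∈ Ez} ([A_i] + [B_i])`, and `[A_i] + [B_i] = [A_i ∧ B_i] + [A_i ∨ B_i]`, so the weight expands over the subsets `T ⊆ Ez` into the BOX weights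
`∏_{i∈T} [WALL_i] · ∏_{i ∈ Ez∖T} [NOCORE_i]`:

* `Coefficientwise.wall_sum_eq_sum_boxes` — the exact expansion `Σ_{wall at z} F(K,K̄) = Σ_{T ⊆ Ez} Σ_{s₀ ⊆ E₀} (∏_{T}[WALL_i] ∏_{Ez∖T}[NOCORE_i]) · F(K,K̄)`;
* `Coefficientwise.wall_sum_nonneg_of_boxes` — hence if every BOX sum on `G − z` (each `z`-neighbour declared 'walled' or 'core-free') is `≥ 0` for `F`, the wall
  sum at `z` is `≥ 0` for `F`.  With `F(K,K̄) = (f K − f K̄)(g K − g K̄)` this is: CONJECTURE BOX of the memo (products of the decreasing single-vertex weights `[t_v = 0]`,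
  `[t_v ≤ 1]`) on graphs with one vertex fewer ⟹ the first rung CW-PA(z) / the point row at `z`.  The pure no-core box `T = ∅` ('no neighbour of `z` is doubly
  reached') is the new, wall-free member of the family (memo §0(i)); exhaustive census of all boxes: 0 negatives on all graphs with ≤ 7 vertices.
[cite: KozmaNitzan2024, Questions 8–9 (§5.5 p. 36) (context: the Question-8 pocket covariance programme)]
-/

namespace Summit.CriticalPhenomena.PercolationContinuityZ3.Theorems

open Finset Literature.Probability.Percolation

namespace Coefficientwise

/-- Indicator algebra: `[A] + [B] = [A ∧ B] + [A ∨ B]`. [cite: KozmaNitzan2024, §5.5 (context only; trivial)] -/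
theorem ite_add_ite_eq_ite_and_add_ite_or (A B : Prop) [Decidable A] [Decidable B] :
    ((if A then (1 : ℝ) else 0) + (if B then (1 : ℝ) else 0)) =
      (if (A ∧ B) then (1 : ℝ) else 0) + (if (A ∨ B) then (1 : ℝ) else 0) := by
  by_cases hA : A <;> by_cases hB : B <;> simp [hA, hB]

variable {ι V : Type*} (ends : ι → Sym2 V)

open Classical in
/-- **The box expansion of the wall sum at `z`.**  For every `F : Set V → Set V → ℝ` and `z ≠ x`,
`Σ_{s ⊆ E : z ∉ C_x(s), z ∉ C_x(E∖s)} F(C_x s, C_x(E∖s)) = Σ_{T ⊆ Ez} Σ_{s₀ ⊆ E₀} (∏_{i∈T} [A_i ∧ B_i](s₀)) (∏_{i∈Ez∖T} [A_i ∨ B_i](s₀)) F(C_x s₀, C_x(E₀∖s₀))`,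
where `A_i(s₀)` / `B_i(s₀)` say that no end `v ≠ z` of the `z`-edge `i` lies in the red / blue cluster of `x` in `G − z` ('wall' resp. 'no-core' at the far end of `i`).
(gen 33's `wall_sum_zStar_prod` + `[A]+[B] = [A∧B]+[A∨B]` + `Finset.prod_add`.)  [cite: KozmaNitzan2024, Questions 8–9 (§5.5 p. 36) (context)] -/
theorem wall_sum_eq_sum_boxes (E : Finset ι) {x z : V} (hxz : z ≠ x) (F : Set V → Set V → ℝ) :
    ∑ s ∈ E.powerset.filter (fun s : Finset ι => z ∉ openCluster (ends '' (↑s : Set ι)) x ∧ z ∉ openCluster (ends '' (↑(E \ s) : Set ι)) x),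
      F (openCluster (ends '' (↑s : Set ι)) x) (openCluster (ends '' (↑(E \ s) : Set ι)) x) =
    ∑ T ∈ (E.filter (fun i => z ∈ ends i)).powerset, ∑ s₀ ∈ (E.filter (fun i => z ∉ ends i)).powerset,
      ((∏ i ∈ T, (if ((∀ v ∈ ends i, v ≠ z → v ∉ openCluster (ends '' (↑s₀ : Set ι)) x) ∧
            (∀ v ∈ ends i, v ≠ z → v ∉ openCluster (ends '' (↑((E.filter (fun i => z ∉ ends i)) \ s₀) : Set ι)) x)) then (1 : ℝ) else 0)) *
        (∏ i ∈ (E.filter (fun i => z ∈ ends i)) \ T, (if ((∀ v ∈ ends i, v ≠ z → v ∉ openCluster (ends '' (↑s₀ : Set ι)) x) ∨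
            (∀ v ∈ ends i, v ≠ z → v ∉ openCluster (ends '' (↑((E.filter (fun i => z ∉ ends i)) \ s₀) : Set ι)) x)) then (1 : ℝ) else 0))) *
        F (openCluster (ends '' (↑s₀ : Set ι)) x) (openCluster (ends '' (↑((E.filter (fun i => z ∉ ends i)) \ s₀) : Set ι)) x) := by
  rw [wall_sum_zStar_prod ends E hxz F, Finset.sum_comm]
  refine Finset.sum_congr rfl fun s₀ _ => ?_
  rw [← Finset.sum_mul]
  congr 1
  rw [← Finset.prod_add]
  refine Finset.prod_congr rfl fun i _ => ?_
  exact ite_add_ite_eq_ite_and_add_ite_or _ _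

open Classical in
/-- **BOX positivity on `G − z` implies the wall sum at `z` is nonnegative.**  If for every set `T` of `z`-edges the box sum
`Σ_{s₀ ⊆ E₀} (∏_{i∈T}[far end of i walled]) (∏_{i∈Ez∖T}[far end of i not doubly reached]) · F(C_x s₀, C_x(E₀∖s₀))` is `≥ 0`, then
`0 ≤ Σ_{s ⊆ E : z ∉ C_x(s), z ∉ C_x(E∖s)} F(C_x s, C_x(E∖s))`.  With `F(K,K̄) = (f K − f K̄)(g K − g K̄)`: prim-lf-2's CONJECTURE BOX (memo CW-BOX-gen46 §0) on the
graph without `z` implies the first rung CW-PA(z) and the coefficientwise point row with wall `{z}`; the term `T = ∅` is the wall-free NO-CORE box.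
[cite: KozmaNitzan2024, Questions 8–9 (§5.5 p. 36) (context)] -/
theorem wall_sum_nonneg_of_boxes (E : Finset ι) {x z : V} (hxz : z ≠ x) (F : Set V → Set V → ℝ)
    (hbox : ∀ T ∈ (E.filter (fun i => z ∈ ends i)).powerset,
      0 ≤ ∑ s₀ ∈ (E.filter (fun i => z ∉ ends i)).powerset,
        ((∏ i ∈ T, (if ((∀ v ∈ ends i, v ≠ z → v ∉ openCluster (ends '' (↑s₀ : Set ι)) x) ∧
              (∀ v ∈ ends i, v ≠ z → v ∉ openCluster (ends '' (↑((E.filter (fun i => z ∉ ends i)) \ s₀) : Set ι)) x)) then (1 : ℝ) else 0)) *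
          (∏ i ∈ (E.filter (fun i => z ∈ ends i)) \ T, (if ((∀ v ∈ ends i, v ≠ z → v ∉ openCluster (ends '' (↑s₀ : Set ι)) x) ∨
              (∀ v ∈ ends i, v ≠ z → v ∉ openCluster (ends '' (↑((E.filter (fun i => z ∉ ends i)) \ s₀) : Set ι)) x)) then (1 : ℝ) else 0))) *
          F (openCluster (ends '' (↑s₀ : Set ι)) x) (openCluster (ends '' (↑((E.filter (fun i => z ∉ ends i)) \ s₀) : Set ι)) x)) :
    0 ≤ ∑ s ∈ E.powerset.filter (fun s : Finset ι => z ∉ openCluster (ends '' (↑s : Set ι)) x ∧ z ∉ openCluster (ends '' (↑(E \ s) : Set ι)) x),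
      F (openCluster (ends '' (↑s : Set ι)) x) (openCluster (ends '' (↑(E \ s) : Set ι)) x) := by
  rw [wall_sum_eq_sum_boxes ends E hxz F]
  exact Finset.sum_nonneg fun T hT => hbox T hT

/-!
### The NO-CORE sum of a vertex (memo §0(i)(c)): inclusion–exclusion and the root-neighbour case

`NO-CORE(y) := Σ_{s : y ∉ C_x(s) ∩ C_x(sᶜ)} Δf Δg` (the vertex `y` is not doubly reached).  Since `{y ∉ K ∩ K̄} = {y ∉ K} ∪ {y ∉ K̄}` and the summand is
invariant under the colour swap `s ↦ sᶜ`, `NO-CORE(y) = 2·OFF(y) − WALL(y)` with `OFF(y) = Σ_{y ∉ C_x(s)} ΔfΔg` (gen 23's theorem `offCluster_twoColouring_nonneg`,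
`A = {y}`) and `WALL(y) = Σ_{y ∉ C_x(s) ∪ C_x(sᶜ)} ΔfΔg` (the point row / first rung at the wall `{y}`).  So CONJECTURE NO-CORE(y) ≥ 0 of the memo reads
`WALL(y) ≤ 2·OFF(y)`; it is trivial when `y` is joined to the root by an edge (then `y` is always reached, `WALL(y) = 0`).
-/

section nocore

variable [Fintype ι] [DecidableEq ι]

omit ends in
/-- Inclusion–exclusion for a swap-invariant summand: `Σ_{P s ∨ P sᶜ} Φ = 2 Σ_{P s} Φ − Σ_{P s ∧ P sᶜ} Φ` when `Φ sᶜ = Φ s`.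
[cite: KozmaNitzan2024, §5.5 (context only; elementary)] -/
theorem sum_filter_or_compl_eq (P : Finset ι → Prop) [DecidablePred P] (Φ : Finset ι → ℝ) (hΦ : ∀ s, Φ sᶜ = Φ s) :
    ∑ s ∈ univ.filter (fun s : Finset ι => P s ∨ P sᶜ), Φ s =
      2 * ∑ s ∈ univ.filter (fun s : Finset ι => P s), Φ s - ∑ s ∈ univ.filter (fun s : Finset ι => P s ∧ P sᶜ), Φ s := by
  have h1 : ∑ s : Finset ι, (if P sᶜ then Φ s else 0) = ∑ s : Finset ι, (if P s then Φ s else 0) := by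
    refine Fintype.sum_equiv (Equiv.mk (fun s : Finset ι => sᶜ) (fun s => sᶜ) (fun s => compl_compl s) (fun s => compl_compl s)) _ _
      (fun s => ?_)
    simp only [Equiv.coe_fn_mk, hΦ]
  have h2 : ∀ s : Finset ι, (if (P s ∨ P sᶜ) then Φ s else 0) =
      (if P s then Φ s else 0) + (if P sᶜ then Φ s else 0) - (if (P s ∧ P sᶜ) then Φ s else 0) := by
    intro s; by_cases ha : P s <;> by_cases hb : P sᶜ <;> simp [ha, hb]
  rw [Finset.sum_filter, Finset.sum_filter, Finset.sum_filter, Finset.sum_congr rfl (fun s _ => h2 s), Finset.sum_sub_distrib,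
    Finset.sum_add_distrib, h1]
  ring

open Classical in
/-- **`NO-CORE(y) = 2·OFF(y) − WALL(y)`.**  For monotone or arbitrary `f, g : Set V → ℝ`, root `x`, vertex `y`, with `K(s) = C_x(s)` the red and `K(sᶜ)` the blue cluster:
`Σ_{s : ¬(y ∈ K s ∧ y ∈ K sᶜ)} (f(K s) − f(K sᶜ))(g(K s) − g(K sᶜ)) = 2·Σ_{s : y ∉ K s} (…) − Σ_{s : y ∉ K s ∧ y ∉ K sᶜ} (…)`.
(prim-lf-2 CW-BOX-gen46 §0(i)(c).)  [cite: KozmaNitzan2024, Questions 8–9 (§5.5 p. 36) (context)] -/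
theorem noCore_sum_eq (x y : V) (f g : Set V → ℝ) :
    ∑ s ∈ univ.filter (fun s : Finset ι =>
        ¬ (y ∈ openCluster (ends '' (↑s : Set ι)) x ∧ y ∈ openCluster (ends '' (↑(sᶜ) : Set ι)) x)),
      (f (openCluster (ends '' (↑s : Set ι)) x) - f (openCluster (ends '' (↑(sᶜ) : Set ι)) x)) *
        (g (openCluster (ends '' (↑s : Set ι)) x) - g (openCluster (ends '' (↑(sᶜ) : Set ι)) x)) =
    2 * ∑ s ∈ univ.filter (fun s : Finset ι => y ∉ openCluster (ends '' (↑s : Set ι)) x),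
      (f (openCluster (ends '' (↑s : Set ι)) x) - f (openCluster (ends '' (↑(sᶜ) : Set ι)) x)) *
        (g (openCluster (ends '' (↑s : Set ι)) x) - g (openCluster (ends '' (↑(sᶜ) : Set ι)) x)) -
    ∑ s ∈ univ.filter (fun s : Finset ι =>
        y ∉ openCluster (ends '' (↑s : Set ι)) x ∧ y ∉ openCluster (ends '' (↑(sᶜ) : Set ι)) x),
      (f (openCluster (ends '' (↑s : Set ι)) x) - f (openCluster (ends '' (↑(sᶜ) : Set ι)) x)) *
        (g (openCluster (ends '' (↑s : Set ι)) x) - g (openCluster (ends '' (↑(sᶜ) : Set ι)) x)) := by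
  set K : Finset ι → Set V := fun s => openCluster (ends '' (↑s : Set ι)) x with hK
  set Φ : Finset ι → ℝ := fun s => (f (K s) - f (K sᶜ)) * (g (K s) - g (K sᶜ)) with hΦ
  have hΦc : ∀ s, Φ sᶜ = Φ s := fun s => by simp only [hΦ, compl_compl]; ring
  have hfilt : univ.filter (fun s : Finset ι => ¬ (y ∈ K s ∧ y ∈ K sᶜ)) = univ.filter (fun s : Finset ι => y ∉ K s ∨ y ∉ K sᶜ) :=
    Finset.filter_congr fun s _ => not_and_or
  change ∑ s ∈ univ.filter (fun s : Finset ι => ¬ (y ∈ K s ∧ y ∈ K sᶜ)), Φ s =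
    2 * ∑ s ∈ univ.filter (fun s : Finset ι => y ∉ K s), Φ s - ∑ s ∈ univ.filter (fun s : Finset ι => y ∉ K s ∧ y ∉ K sᶜ), Φ s
  rw [hfilt]
  exact sum_filter_or_compl_eq (fun s : Finset ι => y ∉ K s) Φ hΦc

open Classical in
/-- **NO-CORE at a neighbour of the root.**  If some edge `i` joins `x` to `y ≠ x`, then `y` is reached in one colour in every colouring, the wall term
vanishes, and `NO-CORE(y) = 2·OFF(y) ≥ 0` by gen 23's `offCluster_twoColouring_nonneg` (`A = {y}`): for monotone `f, g`,
`0 ≤ Σ_{s : ¬(y ∈ C_x(s) ∧ y ∈ C_x(sᶜ))} (f(C_x s) − f(C_x sᶜ))(g(C_x s) − g(C_x sᶜ))`.  (The first non-trivial case of CONJECTURE NO-CORE is dist(x,y) = 2;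
memo CW-BOX-gen46 §0(i)(e).)  [cite: KozmaNitzan2024, Questions 8–9 (§5.5 p. 36) (context)] -/
theorem noCore_twoColouring_nonneg_of_adj (x y : V) (f g : Set V → ℝ) (hf : Monotone f) (hg : Monotone g)
    {i : ι} (hi : ends i = s(x, y)) (hxy : x ≠ y) :
    0 ≤ ∑ s ∈ univ.filter (fun s : Finset ι =>
        ¬ (y ∈ openCluster (ends '' (↑s : Set ι)) x ∧ y ∈ openCluster (ends '' (↑(sᶜ) : Set ι)) x)),
      (f (openCluster (ends '' (↑s : Set ι)) x) - f (openCluster (ends '' (↑(sᶜ) : Set ι)) x)) *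
        (g (openCluster (ends '' (↑s : Set ι)) x) - g (openCluster (ends '' (↑(sᶜ) : Set ι)) x)) := by
  rw [noCore_sum_eq ends x y f g]
  set K : Finset ι → Set V := fun s => openCluster (ends '' (↑s : Set ι)) x with hK
  set Φ : Finset ι → ℝ := fun s => (f (K s) - f (K sᶜ)) * (g (K s) - g (K sᶜ)) with hΦ
  -- `y` is always reached: the edge `i` is red or blue
  have hreach : ∀ s : Finset ι, i ∈ s → y ∈ K s := by
    intro s his
    have hadj : (openGraph (ends '' (↑s : Set ι))).Adj x y := by
      rw [openGraph_image_adj]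
      exact ⟨⟨i, his, hi⟩, hxy⟩
    exact hadj.reachable
  have hwall : univ.filter (fun s : Finset ι => y ∉ K s ∧ y ∉ K sᶜ) = ∅ := by
    refine Finset.filter_false_of_mem fun s _ h => ?_
    by_cases his : i ∈ s
    · exact h.1 (hreach s his)
    · exact h.2 (hreach sᶜ (Finset.mem_compl.mpr his))
  have hoff : 0 ≤ ∑ s ∈ univ.filter (fun s : Finset ι => y ∉ K s), Φ s := by
    have h := offCluster_twoColouring_nonneg ends x ({y} : Set V) f g hf hg
    have hcongr : univ.filter (fun s : Finset ι => ∀ a ∈ ({y} : Set V), a ∉ openCluster (ends '' (↑s : Set ι)) x) =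
        univ.filter (fun s : Finset ι => y ∉ K s) :=
      Finset.filter_congr fun s _ => by simp [hK]
    rw [hcongr] at h
    exact h
  change 0 ≤ 2 * ∑ s ∈ univ.filter (fun s : Finset ι => y ∉ K s), Φ s - ∑ s ∈ univ.filter (fun s : Finset ι => y ∉ K s ∧ y ∉ K sᶜ), Φ s
  rw [hwall, Finset.sum_empty, sub_zero]
  linarith

end nocore

end Coefficientwise

end Summit.CriticalPhenomena.PercolationContinuityZ3.Theorems
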